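import Mathlib.Topology.MetricSpace.Contracting
import Mathlib.Topology.ContinuousMap.Bounded.Normed
import Literature.Analysis.OperatorTheory.LyapunovPerronSums
import HarnessLib

/-!
# The discrete Lyapunov–Perron fixed point (pseudo-stable orbits of `x ↦ m x + G x`)

Analysis/OperatorTheory proofs-layer file (theorems only, no definitions, no named facts),
continuing `LyapunovPerronSums.lean`.

**Setting.** `m` is a bounded operator on a complex Banach space `X` with an exponential
dichotomy relative to an annulus `a < |z| < b` (`b ≤ 1`), encoded WITHOUT spectral theory by:
an idempotent `P` commuting with `m` with `‖mⁿ P‖ ≤ C aⁿ` (forward decay on `PX`), and a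
"backward family" `J n` with `J 0 = 1 − P`, `m J (n+1) = J n`, `‖J n‖ bⁿ ≤ C` (on `(1 − P)X`
one can go back `n` steps at cost `C b⁻ⁿ`) — exactly what the Riesz projections of a
quasi-compact operator provide (`RieszProjectionDichotomy.lean`). `G : X → X` is a nonlinearity
with `G 0 = 0` and a small Lipschitz constant `ε` on the ball of radius `δ`, and `ζ : X → X` is a
Lipschitz "base-point map" (constant `Cζ`) with `ζ 0` small.

**Theorem** (`lyapunovPerron_fixedPoint`). There is `ε > 0`, depending only on
`a, b, C, Cζ`, such that for all such `G, ζ` and `0 < η ≤ δ` with `C ‖ζ 0‖ ≤ η/8` there exist a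
full orbit `x : ℕ → X` of `x ↦ m x + G x` inside the `η`-ball and `u` with `(1 − P) u = u` and
`x 0 = P (ζ u) + u`. (Proof: the Lyapunov–Perron operator
`Φ(x)_k = mᵏP ζ(u(x)) + ∑_{i+j=k-1} mⁱ P G(x_j) − (1 − P) ∑_{i≥0} J_{i+1} (1 − P) G(x_{k+i})`,
`u(x) = −(1 − P)∑_{i≥0} J_{i+1}(1 − P) G(x_i)`, is a `1/2`-contraction of the ball of radius `η`
of the Banach space of sequences with `sup_k γ⁻ᵏ‖x_k‖ < ∞`, `γ = (a+b)/2`, realised on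
`ℕ →ᵇ X` after rescaling by `γᵏ`; its fixed point is an orbit because `m J_{i+1} = J_i`,
`J_0 = 1 − P` and `P + (1 − P) = 1`.) Feeding `ζ(u) = ξ + (graph correction)` gives the local
pseudo-stable manifold as a graph and, with a finite-dimensional `(1 − P)X`, finite-parameter
steering onto it (Henry 1981, Thm. 5.2.1; Hirsch–Pugh–Shub 1977, Thm. 5.1; Irwin 1970).

## References

* D. Henry, *Geometric Theory of Semilinear Parabolic Equations*, LNM 840, Springer 1981,
  §5.2, Thm. 5.2.1 (invariant manifolds of a map near a fixed point by the Lyapunov–Perron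
  method). [Henry1981]
-/

noncomputable section

open _root_.Filter _root_.Topology _root_.Metric _root_.Set Finset
open scoped NNReal BoundedContinuousFunction

namespace Literature.Analysis.OperatorTheory

variable {X : Type*} [NormedAddCommGroup X] [NormedSpace ℂ X] [CompleteSpace X]

/-- **Discrete Lyapunov–Perron theorem (pseudo-stable orbits with prescribed unstable
anchoring).** See the module docstring: given the dichotomy data `P, J, a < b ≤ 1, C` of `m`,
there is `ε > 0` such that for every nonlinearity `G` (`G 0 = 0`, `ε`-Lipschitz on the
`δ`-ball), every `Cζ`-Lipschitz `ζ` and `0 < η ≤ δ` with `C‖ζ 0‖ ≤ η/8`, there are an orbit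
`x (k+1) = m (x k) + G (x k)` with `‖x k‖ ≤ η` for all `k` and `u ∈ (1 − P)X` with
`x 0 = P (ζ u) + u`. [cite: Henry1981, Thm. 5.2.1] -/
theorem lyapunovPerron_fixedPoint {m P : X →L[ℂ] X} {J : ℕ → X →L[ℂ] X} {a b C Cζ : ℝ}
    (ha : 0 < a) (hab : a < b) (hb1 : b ≤ 1) (hC : 1 ≤ C) (hCζ : 0 ≤ Cζ) (hPP : P * P = P)
    (hmP : m * P = P * m) (hJ0 : J 0 = 1 - P) (hJ : ∀ n, m * J (n + 1) = J n)
    (hPn : ∀ n : ℕ, ‖m ^ n * P‖ ≤ C * a ^ n) (hJn : ∀ n : ℕ, ‖J n‖ * b ^ n ≤ C) :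
    ∃ ε : ℝ, 0 < ε ∧ ∀ (G ζ : X → X) (δ η : ℝ), 0 < η → η ≤ δ → G 0 = 0 →
      (∀ v w, ‖v‖ ≤ δ → ‖w‖ ≤ δ → ‖G v - G w‖ ≤ ε * ‖v - w‖) →
      (∀ u u', ‖ζ u - ζ u'‖ ≤ Cζ * ‖u - u'‖) → C * ‖ζ 0‖ ≤ η / 8 →
      ∃ (x : ℕ → X) (u : X), (1 - P) u = u ∧ x 0 = P (ζ u) + u ∧ (∀ k, ‖x k‖ ≤ η) ∧
        ∀ k, x (k + 1) = m (x k) + G (x k) := by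
  -- the projection `Q = 1 − P` and the rate `γ`
  set Q : X →L[ℂ] X := 1 - P with hQdef
  have hJ0' : J 0 = Q := hJ0
  have hQ : ‖Q‖ ≤ C := by have h := hJn 0; rwa [hJ0', pow_zero, mul_one] at h
  have hQQ : Q * Q = Q := by
    rw [hQdef, mul_sub, sub_mul, sub_mul, one_mul, one_mul, mul_one, hPP]; abel
  have hmQ : m * Q = Q * m := by rw [hQdef, mul_sub, sub_mul, mul_one, one_mul, hmP]
  have hPQ : ∀ v : X, P v + Q v = v := fun v => by rw [hQdef]; simp
  set γ : ℝ := (a + b) / 2 with hγdef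
  have hγa : a < γ := by rw [hγdef]; linarith
  have hγb : γ < b := by rw [hγdef]; linarith
  have hγ0 : 0 < γ := ha.trans hγa
  have hγ1 : γ ≤ 1 := (hγb.trans_le hb1).le
  have hb : 0 < b := hγ0.trans hγb
  have hC0 : 0 ≤ C := zero_le_one.trans hC
  have hγk1 : ∀ k : ℕ, γ ^ k ≤ 1 := fun k => pow_le_one₀ hγ0.le hγ1
  have haγk : ∀ k : ℕ, a ^ k ≤ γ ^ k := fun k => pow_le_pow_left₀ ha.le hγa.le k
  -- the constants
  set KA : ℝ := C * (1 - a / γ)⁻¹ / γ with hKA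
  set KB : ℝ := C ^ 2 * b⁻¹ * (1 - γ / b)⁻¹ with hKB
  have hSa : 0 < (1 - a / γ)⁻¹ := inv_pos.2 (by rw [sub_pos, div_lt_one hγ0]; exact hγa)
  have hSb : 0 < (1 - γ / b)⁻¹ := inv_pos.2 (by rw [sub_pos, div_lt_one hb]; exact hγb)
  have hKA0 : 0 ≤ KA := by positivity
  have hKB0 : 0 ≤ KB := by positivity
  set K : ℝ := C ^ 2 * Cζ * KB + KA + C * KB with hK
  have hK0 : 0 ≤ K := by positivity
  refine ⟨1 / (2 * K + 1), by positivity, ?_⟩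
  set ε : ℝ := 1 / (2 * K + 1) with hε
  have hε0 : 0 < ε := by positivity
  have hεK : K * ε ≤ 1 / 2 := by
    rw [hε, mul_one_div, div_le_iff₀ (by positivity)]; linarith
  intro G ζ δ η hη hηδ hG0 hG hζ hζ0
  /- the pieces of the Lyapunov–Perron operator, as functions of `y : ℕ →ᵇ X`
     (`x_k = γᵏ y_k`) -/
  let xf : (ℕ →ᵇ X) → ℕ → X := fun y k => (γ ^ k) • y k
  let g : (ℕ →ᵇ X) → ℕ → X := fun y k => G (xf y k)
  let A' : (ℕ → X) → ℕ → X := fun h n => ∑ p ∈ antidiagonal n, (m ^ p.1 * P) (h p.2)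
  let A : (ℕ → X) → ℕ → X := fun h k => match k with
    | 0 => 0
    | n + 1 => A' h n
  let B : (ℕ → X) → ℕ → X := fun h k => ∑' i : ℕ, (J (i + 1) * Q) (h (k + i))
  let u : (ℕ →ᵇ X) → X := fun y => -(Q (B (g y) 0))
  let z : (ℕ →ᵇ X) → X := fun y => ζ (u y)
  let Φ : (ℕ →ᵇ X) → ℕ → X := fun y k => (m ^ k * P) (z y) + A (g y) k - Q (B (g y) k)
  -- generic estimates for a sequence `h` with `‖h k‖ ≤ t γᵏ`
  have hA : ∀ {h : ℕ → X} {t : ℝ}, 0 ≤ t → (∀ k, ‖h k‖ ≤ t * γ ^ k) →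
      ∀ k, ‖A h k‖ ≤ KA * t * γ ^ k := by
    intro h t ht hh k
    cases k with
    | zero => simp only [A, norm_zero]; positivity
    | succ n =>
      calc ‖A' h n‖ ≤ C * (1 - a / γ)⁻¹ * t * γ ^ n :=
            norm_sum_antidiagonal_le ha.le hγa ht hPn hh n
        _ = KA * t * γ ^ (n + 1) := by rw [hKA, pow_succ]; field_simp
  have hBs : ∀ {h : ℕ → X} {t : ℝ}, 0 ≤ t → (∀ k, ‖h k‖ ≤ t * γ ^ k) →
      ∀ k, Summable fun i : ℕ => (J (i + 1) * Q) (h (k + i)) :=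
    fun ht hh k => summable_backward_tail hγ0.le hγb ht hJn hQ hh k
  have hB : ∀ {h : ℕ → X} {t : ℝ}, 0 ≤ t → (∀ k, ‖h k‖ ≤ t * γ ^ k) →
      ∀ k, ‖B h k‖ ≤ KB * t * γ ^ k := by
    intro h t ht hh k
    calc ‖B h k‖ ≤ C ^ 2 * b⁻¹ * (1 - γ / b)⁻¹ * t * γ ^ k :=
          norm_tsum_backward_tail_le hγ0.le hγb ht hJn hQ hh k
      _ = KB * t * γ ^ k := by rw [hKB]
  have hQB : ∀ {h : ℕ → X} {t : ℝ}, 0 ≤ t → (∀ k, ‖h k‖ ≤ t * γ ^ k) →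
      ∀ k, ‖Q (B h k)‖ ≤ C * KB * t * γ ^ k := fun ht hh k =>
    (Q.le_opNorm _).trans ((mul_le_mul hQ (hB ht hh k) (norm_nonneg _) hC0).trans_eq (by ring))
  -- linearity of `A` and `B`
  have hA_sub : ∀ (h h' : ℕ → X) (k : ℕ), A h k - A h' k = A (fun j => h j - h' j) k := by
    intro h h' k
    cases k with
    | zero => simp [A]
    | succ n => simp only [A, A', ← sum_sub_distrib, map_sub]
  have hB_sub : ∀ {h h' : ℕ → X} (k : ℕ), (Summable fun i : ℕ => (J (i + 1) * Q) (h (k + i))) →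
      (Summable fun i : ℕ => (J (i + 1) * Q) (h' (k + i))) →
      B h k - B h' k = B (fun j => h j - h' j) k := by
    intro h h' k hs hs'
    simp only [B, ← hs.tsum_sub hs', map_sub]
  -- the nonlinearity along `x_k = γᵏ y_k`
  have hxf : ∀ (y : ℕ →ᵇ X) (k : ℕ), ‖xf y k‖ ≤ γ ^ k * ‖y‖ := fun y k => by
    change ‖(γ ^ k) • y k‖ ≤ _
    rw [norm_smul, Real.norm_of_nonneg (pow_nonneg hγ0.le k)]
    exact mul_le_mul_of_nonneg_left (y.norm_coe_le_norm k) (pow_nonneg hγ0.le k)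
  have hxfδ : ∀ (y : ℕ →ᵇ X), ‖y‖ ≤ η → ∀ k, ‖xf y k‖ ≤ δ := fun y hy k =>
    (hxf y k).trans ((mul_le_of_le_one_left (norm_nonneg _) (hγk1 k)).trans (hy.trans hηδ))
  have hg : ∀ (y : ℕ →ᵇ X), ‖y‖ ≤ η → ∀ k, ‖g y k‖ ≤ ε * ‖y‖ * γ ^ k := by
    intro y hy k
    have h := hG (xf y k) 0 (hxfδ y hy k) (by rw [norm_zero]; exact hη.le.trans hηδ)
    rw [hG0, sub_zero, sub_zero] at h
    calc ‖g y k‖ ≤ ε * ‖xf y k‖ := h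
      _ ≤ ε * (γ ^ k * ‖y‖) := mul_le_mul_of_nonneg_left (hxf y k) hε0.le
      _ = ε * ‖y‖ * γ ^ k := by ring
  have hg_sub : ∀ (y y' : ℕ →ᵇ X), ‖y‖ ≤ η → ‖y'‖ ≤ η →
      ∀ k, ‖g y k - g y' k‖ ≤ ε * ‖y - y'‖ * γ ^ k := by
    intro y y' hy hy' k
    calc ‖g y k - g y' k‖ ≤ ε * ‖xf y k - xf y' k‖ := hG _ _ (hxfδ y hy k) (hxfδ y' hy' k)
      _ ≤ ε * (γ ^ k * ‖y - y'‖) := by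
          refine mul_le_mul_of_nonneg_left ?_ hε0.le
          change ‖(γ ^ k) • y k - (γ ^ k) • y' k‖ ≤ _
          rw [← smul_sub, norm_smul, Real.norm_of_nonneg (pow_nonneg hγ0.le k)]
          exact mul_le_mul_of_nonneg_left ((y - y').norm_coe_le_norm k) (pow_nonneg hγ0.le k)
      _ = ε * ‖y - y'‖ * γ ^ k := by ring
  -- bounds for `u`, `z`, `Φ`
  have hu : ∀ (y : ℕ →ᵇ X), ‖y‖ ≤ η → ‖u y‖ ≤ C * KB * (ε * ‖y‖) := fun y hy => by
    have h := hQB (by positivity) (hg y hy) 0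
    rw [pow_zero, mul_one] at h
    simpa only [u, norm_neg] using h
  have hu_sub : ∀ (y y' : ℕ →ᵇ X), ‖y‖ ≤ η → ‖y'‖ ≤ η →
      ‖u y - u y'‖ ≤ C * KB * (ε * ‖y - y'‖) := fun y y' hy hy' => by
    have h := hQB (by positivity) (hg_sub y y' hy hy') 0
    rw [pow_zero, mul_one] at h
    have heq : u y - u y' = -(Q (B (fun j => g y j - g y' j) 0)) := by
      simp only [u, ← hB_sub 0 (hBs (by positivity) (hg y hy) 0) (hBs (by positivity) (hg y' hy') 0),
        map_sub]
      abel
    rw [heq, norm_neg]; exact h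
  have hΦ : ∀ (y : ℕ →ᵇ X), ‖y‖ ≤ η → ∀ k, ‖Φ y k‖ ≤ γ ^ k * η := by
    intro y hy k
    have hy0 : 0 ≤ ‖y‖ := norm_nonneg _
    have h1 : ‖(m ^ k * P) (z y)‖ ≤ C * γ ^ k * (‖ζ 0‖ + Cζ * (C * KB * (ε * ‖y‖))) := by
      calc ‖(m ^ k * P) (z y)‖ ≤ ‖m ^ k * P‖ * ‖z y‖ := (m ^ k * P).le_opNorm _
        _ ≤ (C * γ ^ k) * (‖ζ 0‖ + Cζ * (C * KB * (ε * ‖y‖))) := by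
            refine mul_le_mul ((hPn k).trans (mul_le_mul_of_nonneg_left (haγk k) hC0)) ?_
              (norm_nonneg _) (by positivity)
            calc ‖z y‖ = ‖(ζ (u y) - ζ 0) + ζ 0‖ := by simp only [z, sub_add_cancel]
              _ ≤ ‖ζ (u y) - ζ 0‖ + ‖ζ 0‖ := norm_add_le _ _
              _ ≤ Cζ * ‖u y - 0‖ + ‖ζ 0‖ := by gcongr; exact hζ _ _
              _ ≤ Cζ * (C * KB * (ε * ‖y‖)) + ‖ζ 0‖ := by
                  rw [sub_zero]; gcongr; exact hu y hy
              _ = ‖ζ 0‖ + Cζ * (C * KB * (ε * ‖y‖)) := add_comm _ _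
        _ = C * γ ^ k * (‖ζ 0‖ + Cζ * (C * KB * (ε * ‖y‖))) := rfl
    have h2 : ‖A (g y) k‖ ≤ KA * (ε * ‖y‖) * γ ^ k := hA (by positivity) (hg y hy) k
    have h3 : ‖Q (B (g y) k)‖ ≤ C * KB * (ε * ‖y‖) * γ ^ k := hQB (by positivity) (hg y hy) k
    calc ‖Φ y k‖ ≤ ‖(m ^ k * P) (z y)‖ + ‖A (g y) k‖ + ‖Q (B (g y) k)‖ :=
          (norm_sub_le _ _).trans (add_le_add (norm_add_le _ _) le_rfl)
      _ ≤ C * γ ^ k * (‖ζ 0‖ + Cζ * (C * KB * (ε * ‖y‖))) + KA * (ε * ‖y‖) * γ ^ k +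
            C * KB * (ε * ‖y‖) * γ ^ k := add_le_add (add_le_add h1 h2) h3
      _ = γ ^ k * (C * ‖ζ 0‖ + (K * ε) * ‖y‖) := by rw [hK]; ring
      _ ≤ γ ^ k * (η / 8 + (1 / 2) * η) :=
          mul_le_mul_of_nonneg_left (add_le_add hζ0 (mul_le_mul hεK hy hy0 (by norm_num)))
            (pow_nonneg hγ0.le k)
      _ ≤ γ ^ k * η := mul_le_mul_of_nonneg_left (by linarith) (pow_nonneg hγ0.le k)
  have hΦ_sub : ∀ (y y' : ℕ →ᵇ X), ‖y‖ ≤ η → ‖y'‖ ≤ η →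
      ∀ k, ‖Φ y k - Φ y' k‖ ≤ γ ^ k * ((1 / 2) * ‖y - y'‖) := by
    intro y y' hy hy' k
    have hd0 : 0 ≤ ‖y - y'‖ := norm_nonneg _
    have h1 : ‖(m ^ k * P) (z y) - (m ^ k * P) (z y')‖ ≤
        C * γ ^ k * (Cζ * (C * KB * (ε * ‖y - y'‖))) := by
      rw [← map_sub]
      calc ‖(m ^ k * P) (z y - z y')‖ ≤ ‖m ^ k * P‖ * ‖z y - z y'‖ := (m ^ k * P).le_opNorm _
        _ ≤ (C * γ ^ k) * (Cζ * (C * KB * (ε * ‖y - y'‖))) := by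
            refine mul_le_mul ((hPn k).trans (mul_le_mul_of_nonneg_left (haγk k) hC0)) ?_
              (norm_nonneg _) (by positivity)
            exact (hζ _ _).trans (mul_le_mul_of_nonneg_left (hu_sub y y' hy hy') hCζ)
        _ = _ := rfl
    have h2 : ‖A (g y) k - A (g y') k‖ ≤ KA * (ε * ‖y - y'‖) * γ ^ k := by
      rw [hA_sub]; exact hA (by positivity) (hg_sub y y' hy hy') k
    have h3 : ‖Q (B (g y) k) - Q (B (g y') k)‖ ≤ C * KB * (ε * ‖y - y'‖) * γ ^ k := by
      rw [← map_sub, hB_sub k (hBs (by positivity) (hg y hy) k) (hBs (by positivity) (hg y' hy') k)]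
      exact hQB (by positivity) (hg_sub y y' hy hy') k
    have heq : Φ y k - Φ y' k = ((m ^ k * P) (z y) - (m ^ k * P) (z y')) +
        (A (g y) k - A (g y') k) - (Q (B (g y) k) - Q (B (g y') k)) := by
      simp only [Φ]; abel
    rw [heq]
    calc ‖((m ^ k * P) (z y) - (m ^ k * P) (z y')) + (A (g y) k - A (g y') k) -
          (Q (B (g y) k) - Q (B (g y') k))‖
        ≤ ‖(m ^ k * P) (z y) - (m ^ k * P) (z y')‖ + ‖A (g y) k - A (g y') k‖ +
            ‖Q (B (g y) k) - Q (B (g y') k)‖ :=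
          (norm_sub_le _ _).trans (add_le_add (norm_add_le _ _) le_rfl)
      _ ≤ C * γ ^ k * (Cζ * (C * KB * (ε * ‖y - y'‖))) + KA * (ε * ‖y - y'‖) * γ ^ k +
            C * KB * (ε * ‖y - y'‖) * γ ^ k := add_le_add (add_le_add h1 h2) h3
      _ = γ ^ k * ((K * ε) * ‖y - y'‖) := by rw [hK]; ring
      _ ≤ γ ^ k * ((1 / 2) * ‖y - y'‖) :=
          mul_le_mul_of_nonneg_left (mul_le_mul_of_nonneg_right hεK hd0) (pow_nonneg hγ0.le k)
  -- the Lyapunov–Perron operator on `ℕ →ᵇ X`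
  have hΨb : ∀ (y : ℕ →ᵇ X), ‖y‖ ≤ η → ∀ k, ‖(γ ^ k)⁻¹ • Φ y k‖ ≤ η := by
    intro y hy k
    rw [norm_smul, norm_inv, Real.norm_of_nonneg (pow_nonneg hγ0.le k),
      inv_mul_le_iff₀ (pow_pos hγ0 k)]
    exact hΦ y hy k
  let Ψ : (ℕ →ᵇ X) → (ℕ →ᵇ X) := fun y =>
    if hy : ‖y‖ ≤ η then
      BoundedContinuousFunction.ofNormedAddCommGroupDiscrete (fun k => (γ ^ k)⁻¹ • Φ y k) η (hΨb y hy)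
    else 0
  have hΨ_apply : ∀ (y : ℕ →ᵇ X), ‖y‖ ≤ η → ∀ k, Ψ y k = (γ ^ k)⁻¹ • Φ y k := by
    intro y hy k
    simp only [Ψ, dif_pos hy, BoundedContinuousFunction.coe_ofNormedAddCommGroupDiscrete]
  have hΨ_norm : ∀ (y : ℕ →ᵇ X), ‖y‖ ≤ η → ‖Ψ y‖ ≤ η := by
    intro y hy
    simp only [Ψ, dif_pos hy]
    exact BoundedContinuousFunction.norm_ofNormedAddCommGroup_le _ hη.le _
  set S : Set (ℕ →ᵇ X) := closedBall 0 η with hS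
  have hmem : ∀ {y : ℕ →ᵇ X}, y ∈ S ↔ ‖y‖ ≤ η := fun {y} => by
    rw [hS, mem_closedBall, dist_zero_right]
  have hmaps : MapsTo Ψ S S := fun y hy => hmem.2 (hΨ_norm y (hmem.1 hy))
  have hhalf : ((2⁻¹ : ℝ≥0) : ℝ) = 1 / 2 := by rw [NNReal.coe_inv, NNReal.coe_ofNat, one_div]
  have hK1 : (2⁻¹ : ℝ≥0) < 1 := by rw [← NNReal.coe_lt_coe, hhalf, NNReal.coe_one]; norm_num
  have hlip : LipschitzOnWith (2⁻¹ : ℝ≥0) Ψ S := by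
    refine LipschitzOnWith.of_dist_le_mul fun y hy y' hy' => ?_
    have hyη := hmem.1 hy
    have hy'η := hmem.1 hy'
    rw [hhalf]
    refine (BoundedContinuousFunction.dist_le (by positivity)).2 fun k => ?_
    rw [dist_eq_norm, hΨ_apply y hyη, hΨ_apply y' hy'η, ← smul_sub, norm_smul, norm_inv,
      Real.norm_of_nonneg (pow_nonneg hγ0.le k), inv_mul_le_iff₀ (pow_pos hγ0 k), dist_eq_norm]
    exact hΦ_sub y y' hyη hy'η k
  have hcontr : ContractingWith (2⁻¹ : ℝ≥0) (hmaps.restrict Ψ S S) :=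
    ⟨hK1, (hmaps.lipschitzOnWith_iff_restrict).1 hlip⟩
  have h0S : (0 : ℕ →ᵇ X) ∈ S := hmem.2 (by rw [norm_zero]; exact hη.le)
  obtain ⟨y, hyS, hfix, -, -⟩ := ContractingWith.exists_fixedPoint'
    (isClosed_closedBall.isComplete) hmaps hcontr h0S (edist_ne_top _ _)
  have hyη : ‖y‖ ≤ η := hmem.1 hyS
  -- the fixed point is an orbit `x_k = γᵏ y_k = Φ y k`
  have hΦx : ∀ k, Φ y k = xf y k := by
    intro k
    have h : Ψ y k = y k := congrArg (fun f : ℕ →ᵇ X => f k) hfix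
    rw [hΨ_apply y hyη] at h
    change Φ y k = (γ ^ k) • y k
    rw [← h, smul_inv_smul₀ (pow_ne_zero k hγ0.ne')]
  refine ⟨xf y, u y, ?_, ?_, ?_, ?_⟩
  · -- `Q u = u`
    change Q (-(Q (B (g y) 0))) = -(Q (B (g y) 0))
    rw [map_neg, ← mul_apply_eq_comp, hQQ]
  · -- `x 0 = P (ζ u) + u`
    rw [← hΦx 0]
    change (m ^ 0 * P) (z y) + 0 - Q (B (g y) 0) = P (ζ (u y)) + -(Q (B (g y) 0))
    rw [pow_zero, one_mul, add_zero, sub_eq_add_neg]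
  · -- the orbit stays in the `η`-ball
    intro k
    calc ‖xf y k‖ ≤ γ ^ k * ‖y‖ := hxf y k
      _ ≤ 1 * η := mul_le_mul (hγk1 k) hyη (norm_nonneg _) zero_le_one
      _ = η := one_mul η
  · -- `x (k+1) = m (x k) + G (x k)`
    intro k
    have hsk := hBs (by positivity) (hg y hyη) k
    have hsk1 := hBs (by positivity) (hg y hyη) (k + 1)
    have hmB : m (B (g y) k) = Q (Q (g y k)) + B (g y) (k + 1) :=
      map_tsum_backward_tail hJ0' hJ k hsk hsk1
    have hmA : m (A (g y) k) = A (g y) (k + 1) - P (g y k) := by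
      cases k with
      | zero =>
        change m 0 = A' (g y) 0 - P (g y 0)
        simp [A']
      | succ n =>
        change m (A' (g y) n) = A' (g y) (n + 1) - P (g y (n + 1))
        simp only [A', Nat.sum_antidiagonal_succ, pow_zero, one_mul, map_sum]
        rw [add_sub_cancel_left]
        refine sum_congr rfl fun p _ => ?_
        rw [← mul_apply_eq_comp, ← mul_assoc, ← pow_succ']
    have hmz : m ((m ^ k * P) (z y)) = (m ^ (k + 1) * P) (z y) := by
      rw [← mul_apply_eq_comp, ← mul_assoc, ← pow_succ']
    have hmQB : m (Q (B (g y) k)) = Q (g y k) + Q (B (g y) (k + 1)) := by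
      rw [← mul_apply_eq_comp, hmQ, mul_apply_eq_comp, hmB, map_add, ← mul_apply_eq_comp, hQQ,
        ← mul_apply_eq_comp, hQQ]
    have key : P (g y k) + Q (g y k) = g y k := hPQ (g y k)
    have hstep : Φ y (k + 1) = m (Φ y k) + g y k := by
      simp only [Φ, map_add, map_sub, hmz, hmA, hmQB]
      set pg := P (g y k)
      set qg := Q (g y k)
      rw [← key]
      abel
    calc xf y (k + 1) = Φ y (k + 1) := (hΦx (k + 1)).symm
      _ = m (Φ y k) + g y k := hstep
      _ = m (xf y k) + G (xf y k) := by rw [hΦx k]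

end Literature.Analysis.OperatorTheory
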